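import Summits.BirchSwinnertonDyer.BirchSwinnertonDyer.Theorems.KatoDescentPotSupersingularTowerTorsionInversionElement
import Literature.NumberTheory.EllipticCurves.IwasawaTowerTorsionPotGoodLocal
import HarnessLib

/-!
# IMAI 1975 IS A TREE THEOREM: `W(ℚ_{p,∞})[p^∞]` is finite at EVERY prime `p` of potentially good reduction — the named fact
# `imai1975_finite_fixedPoints_kerSubgroup_inf_decomp_of_padicValRat_j_nonneg` (p678243) PROVED, verbatim
# (route-free helper for crux M = stmt-BirchSwinnertonDyer-19196 `ReducibleKatoMember`, K9 / K8-t′; seat `bsd-potss-rkm` g32)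

The Literature named fact `Literature.NumberTheory.EllipticCurves.imai1975_finite_fixedPoints_kerSubgroup_inf_decomp_of_padicValRat_j_nonneg`
(Imai, Proc. Japan Acad. 51 (1975), Theorem p. 12, read for elliptic curves over `ℚ` at the cyclotomic `ℤ_p`-layer; seat g30, review
lane) says: for every elliptic `W/ℚ`, every prime `p` with `0 ≤ ord_p j(W)`, the cyclotomic `ℤ_p`-extension `κ` and the place `v` at `p`,
`Finite (FixedPoints.addSubgroup ↥(κ.kerSubgroup ⊓ GreenbergSelmer.decomp v) (W.geomPrimaryTorsion p))`.  Its `Proofs`-style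
discharge cannot live under `Literature/` (the proof uses the Summits-side tools of cells `bsd-potss` / `bsd-wall` / `bsd-schneider`),
so it is recorded HERE, as a theorem whose type is the fact VERBATIM:

* `finite_fixedPoints_kerSubgroup_inf_decomp_two` — `p = 2` (both potentially supersingular and potentially ordinary rows): the
  parity-free parts of FILES 1–3 (Serre 1967 Prop. 8 holds at `p = 2`; the local ordinary lemma and the transport never used `p ≠ 2`)
  combined with the `p = 2` input of `…TowerTorsionInversionElement` (a `4`-torsion point moved by an element of `D_v ⊓ ker κ` inverting
  `μ_{2^∞}`) through the line-free reduction with a moved `p`-PRIMARY point;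
* `finite_fixedPoints_kerSubgroup_inf_decomp` — every prime: `p = 2` above, `p` odd = FILE 3's
  `finite_fixedPoints_kerSubgroup_inf_decomp_of_padicValRat_j_nonneg` (potentially supersingular: g31 p680430 over bsd-wall's Serre
  theorem; potentially ordinary: g32);
* **`imai1975_finite_fixedPoints_kerSubgroup_inf_decomp_of_padicValRat_j_nonneg_holds :
  imai1975_finite_fixedPoints_kerSubgroup_inf_decomp_of_padicValRat_j_nonneg`** — the named fact, PROVED (net named-fact debt of the
  cell −1 in substance; the `def` stays in `Literature/` for its statement-only consumers, who may now cite this theorem: H2X / H2X⁺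
  `hfin`, `ContraRealizable` §3 `hImai` (cell `bsd-cm`), `CoreInputsOfFine.exists_memberHullZetaCoreInputs_of_fineInputs` (g30));
* (g30's schema theorem `CoreInputsOfFine.exists_memberHullZetaCoreInputs_of_fineInputs` (p677595 §3) now has its displayed `hImai`
  dischargeable by `finite_fixedPoints_kerSubgroup_inf_decomp`; the resulting Imai-free package is already landed as
  `FineInputsNoImai.exists_memberHullZetaCoreInputs_of_fineInputs`, p685169.)

INGREDIENTS (all tree theorems): Serre 1967 §5 Prop. 8 (`Serre1967.noStableDivisibleLine_of_potentiallySupersingular_holds`, bsd-wall);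
kmc g16's line-free reduction and Weil-pairing mover; the reduction map at a good ordinary place with its Frobenius equivariance
(`exists_goodReductionHom_frobenius`); the Weil pairing (`exists_weilPairing_holds`); the ramified cyclotomic lemma (p683052) and the
inversion element (this seat); potential good reduction over `ℚ(E[4])` / `ℚ(E[3])`.  NOT used: unit-root eigenvalues, weights, formal
groups over ramified bases, Sen theory, `p`-adic Hodge theory.

HONEST FRAMING.  Theorems only (no definition, no named fact, no `sorry`); route-free; closes no item by itself; BSD is proved for no
curve.  The fact is Imai's theorem for ELLIPTIC CURVES OVER `ℚ` at the cyclotomic `ℤ_p`-layer only (weaker than print: abelian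
varieties over `p`-adic fields, full torsion of `A(k(μ_{p^∞}))`).

References: [Imai1975] Theorem (p. 12); [Serre1967GroupesPDivisibles] §5 Prop. 8; [GreenbergLNM1716] §1 p. 62, §2 p. 70, §3 Lemma 3.3
(p. 87); [SilvermanAEC2009] Prop. III.8.1, VII.§2, VII.5.5; [Kato2004Asterisque] (14.9.1) (p. 239) (the consumer `hfin`).
-/

-- the summit and its single problem are both named `BirchSwinnertonDyer` (registry layout D-0017)
set_option linter.dupNamespace false
set_option autoImplicit false

noncomputable section

open scoped Classical NumberField
open Function Field NumberField IsDedekindDomain WeierstrassCurve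
open Literature.NumberTheory.EllipticCurves Literature.NumberTheory.EllipticCurves.GreenbergSelmer
open Literature.NumberTheory.GaloisRepresentations
open Summit.BirchSwinnertonDyer.BirchSwinnertonDyer.Theorems.SchneiderFreeControlAtoms

universe u

namespace Summit.BirchSwinnertonDyer.BirchSwinnertonDyer.Theorems.TowerTorsionFiniteOrdinary

/-- Transport of the «no stable divisible line» statement along an EQUALITY of Weierstrass curves (for `W.baseChange ℚ = W`; the
g31 file keeps its copy private). [folklore] -/
theorem noStableDivisibleLine_of_eq' {K : Type} [Field K] [NumberField K] {E E' : WeierstrassCurve K}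
    (h : E = E') (p : ℕ) (𝔭 : HeightOneSpectrum (𝓞 K))
    (hE : ∀ N : AddSubgroup (E.geomPrimaryTorsion p),
      (∀ d ∈ decomp 𝔭, ∀ c ∈ N, d • c ∈ N) → (∀ c ∈ N, ∃ c' ∈ N, p • c' = c) →
      Set.ncard {c : E.geomPrimaryTorsion p | c ∈ N ∧ p • c = 0} ≤ p → N = ⊥) :
    ∀ N : AddSubgroup (E'.geomPrimaryTorsion p),
      (∀ d ∈ decomp 𝔭, ∀ c ∈ N, d • c ∈ N) → (∀ c ∈ N, ∃ c' ∈ N, p • c' = c) →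
      Set.ncard {c : E'.geomPrimaryTorsion p | c ∈ N ∧ p • c = 0} ≤ p → N = ⊥ := by
  subst h
  exact hE

/-- **Imai's finiteness at `p = 2`** (`0 ≤ ord_2 j(W)`, `κ` the cyclotomic `ℤ_2`-extension, `v` the place at `2`): on the potentially
supersingular rows no `D_v`-stable divisible line exists at all (Serre 1967 Prop. 8, tree theorem, `p = 2` included); on the potentially
ordinary rows none is fixed by the tower group (FILE 3, parity-free); and the tower group moves a `4`-torsion point
(`exists_primaryTorsion_not_fixed_rat_two`). [cite: Imai1975, Theorem (p. 12)] [cite: Serre1967GroupesPDivisibles, §5 Prop. 8]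
[cite: GreenbergLNM1716, §3 Lemma 3.3 (p. 87)] -/
theorem finite_fixedPoints_kerSubgroup_inf_decomp_two (W : WeierstrassCurve ℚ) [W.IsElliptic] (p : ℕ) [Fact p.Prime]
    (hp2 : p = 2) (hj : 0 ≤ padicValRat p W.j) (κ : ZpExtension ℚ p) (hκ : κ.IsCyclotomic) (v : HeightOneSpectrum (𝓞 ℚ))
    (hv : ((Rat.HeightOneSpectrum.primesEquiv v : Nat.Primes) : ℕ) = p) :
    Finite (FixedPoints.addSubgroup ↥(κ.kerSubgroup ⊓ decomp v) (W.geomPrimaryTorsion p)) := by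
  have hpr : p.Prime := Fact.out
  have hpv : ((p : ℕ) : 𝓞 ℚ) ∈ v.asIdeal :=
    (natCast_mem_asIdeal_iff_eq_primesEquiv_symm v hpr).mpr ((Equiv.eq_symm_apply _).mpr (Subtype.ext hv))
  have hmove := exists_primaryTorsion_not_fixed_rat_two W p hp2 κ hκ v hv
  have hfin : LocalTowerTorsionFiniteAt W p κ v := by
    by_cases hss : ∀ (F : Type) [Field F] [NumberField F] (w : HeightOneSpectrum (𝓞 F)),
        ((p : ℕ) : 𝓞 F) ∈ w.asIdeal → (W.baseChange F).HasGoodReductionAt w → ¬ (W.baseChange F).HasUnitRootAt w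
    · have hline := noStableDivisibleLine_of_eq' (TowerTorsionFinite.baseChange_rat_eq W) p v
        (Serre1967.noStableDivisibleLine_of_potentiallySupersingular_holds W p hj hss ℚ v hpv)
      exact W.localTowerTorsionFiniteAt_of_noFixedStableDivisibleLine' p κ v
        (fun N hst hdiv hcard _ ↦ hline N hst hdiv hcard) hmove
    · push Not at hss
      obtain ⟨F, _, _, w, hw, hgood, hunit⟩ := hss
      exact W.localTowerTorsionFiniteAt_of_noFixedStableDivisibleLine' p κ v
        (fun N _ hNdiv _ hNfix ↦
          eq_bot_of_divisible_of_fixed_of_potentiallyOrdinary W p w hw hgood hunit κ hκ v hpv N hNdiv hNfix) hmove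
  unfold LocalTowerTorsionFiniteAt at hfin
  rw [inf_comm]
  exact hfin.to_subtype

/-- **Imai's finiteness `W(ℚ_{p,∞})[p^∞] < ∞` at EVERY prime of potentially good reduction** (`0 ≤ ord_p j(W)`, `κ` cyclotomic, `v`
the place at `p`): `p = 2` by `finite_fixedPoints_kerSubgroup_inf_decomp_two`, odd `p` by FILE 3.
[cite: Imai1975, Theorem (p. 12)] [cite: Serre1967GroupesPDivisibles, §5 Prop. 8] [cite: GreenbergLNM1716, §1 p. 62, §3 Lemma 3.3 (p. 87)] -/
theorem finite_fixedPoints_kerSubgroup_inf_decomp (W : WeierstrassCurve ℚ) [W.IsElliptic] (p : ℕ) [Fact p.Prime]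
    (hj : 0 ≤ padicValRat p W.j) (κ : ZpExtension ℚ p) (hκ : κ.IsCyclotomic) (v : HeightOneSpectrum (𝓞 ℚ))
    (hv : ((Rat.HeightOneSpectrum.primesEquiv v : Nat.Primes) : ℕ) = p) :
    Finite (FixedPoints.addSubgroup ↥(κ.kerSubgroup ⊓ decomp v) (W.geomPrimaryTorsion p)) := by
  by_cases hp2 : p = 2
  · exact finite_fixedPoints_kerSubgroup_inf_decomp_two W p hp2 hj κ hκ v hv
  · exact finite_fixedPoints_kerSubgroup_inf_decomp_of_padicValRat_j_nonneg W p hp2 hj κ hκ v hv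

/-- **IMAI 1975 (the tree's named fact `imai1975_finite_fixedPoints_kerSubgroup_inf_decomp_of_padicValRat_j_nonneg`), PROVED — type
VERBATIM the Literature `def`.**  For every elliptic curve `W/ℚ`, every prime `p` with `0 ≤ ord_p j(W)`, the cyclotomic
`ℤ_p`-extension `κ` of `ℚ` and the place `v` of `ℚ` at `p`, the points of `W(ℚ̄)[p^∞]` fixed by `ker κ ⊓ D_v` — `W(ℚ_{p,∞})[p^∞]` —
form a finite group. [cite: Imai1975, Theorem (p. 12)] [cite: Serre1967GroupesPDivisibles, §5 Prop. 8]
[cite: GreenbergLNM1716, §1 p. 62, §2 p. 70, §3 Lemma 3.3 (p. 87)] [cite: SilvermanAEC2009, Prop. III.8.1 and Prop. VII.5.5] -/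
theorem imai1975_finite_fixedPoints_kerSubgroup_inf_decomp_of_padicValRat_j_nonneg_holds :
    Literature.NumberTheory.EllipticCurves.imai1975_finite_fixedPoints_kerSubgroup_inf_decomp_of_padicValRat_j_nonneg := by
  intro W _ p _ κ v hj hκ hv
  exact finite_fixedPoints_kerSubgroup_inf_decomp W p hj κ hκ v hv

end Summit.BirchSwinnertonDyer.BirchSwinnertonDyer.Theorems.TowerTorsionFiniteOrdinary

end
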